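import Summits.QuantumFields.YangMills.Theses.FradkinShenkerFlow
import Literature.MathematicalPhysics.QuantumFieldTheory.LatticeGaugeProofs
import Summits.QuantumFields.YangMills.Theorems.ClusteringToYangMills.Negative.DisproofBurden
import HarnessLib.Audit

/-!
# Line `slab-coupling-response` — crux `ClusteringToYangMills` (stmt-QuantumFields-9443)

Skeleton of the line "modulate the coupling in a slab: the non-Gaussianity (and non-triviality)
clauses of `YangMills` as a first-order RESPONSE identity, contact-free by construction" for the
crux `Summit.QuantumFields.YangMills.Theses.FradkinShenkerFlow.ClusteringToYangMills`
(`LatticeClustering → YangMills`, route `FradkinShenkerFlow`, rank 4, the imported complement).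
Idea card `Cruxes/ClusteringToYangMills/Ideas/slab-coupling-response.md` (triage r1-1/2/3: pass,
"doubted, not broken"); engine credited to crux idea `running-pole-skewness` (crux 8646).

## The line in one paragraph

For ANY probability measure `μ` and bounded `F, G, W`, `t ↦ Cov_{μ.tilted(tW)}(F, G)` has derivative
`κ₃(F, G, W)` at `0`.  With `μ` the torus Wilson state, `F = φ(f)`, `G = φ(g)` smeared curvature
fields and `W = ∑_y h(a y) P_y` (`P` = the curvature species = `∂(action)/∂β` per site, `h`
supported in the time slab BETWEEN the supports of `f` and `g`), `μ.tilted(tW)` is Wilson's measure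
with coupling `β + t h(a y)` on the plaquettes at `y`, and the identity says: the response of the
two-point function to raising the coupling INSIDE the slab equals the `h`-weighted, off-diagonal
three-point cumulant of the curvature species — no contact term, no mixing, no counterterm (they
live where `h = 0`); `c_k³ a_k⁴ ×` it is literally the witness functional of `OSData.IsNonGaussian`
for the scheme's renormalised fields (`stub_slabResponseIdentity`, `stub_cumulantWitness`).  The
response is non-zero because raising `β` in the slab LENGTHENS THE CORRELATION LENGTH THERE: by the
transfer-matrix anatomy (Feynman–Hellmann on the isolated one-particle shell) it is
`≈ -(τ/a) E′(β) Cov(φf, φg)`, non-zero as soon as the scalar mass RUNS at the coupling used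
(`stub_slabSumRule`), and the crux's `∀ β ≥ β₀` lets the scheme SIT at couplings where it runs:
asymptotic-freedom-shaped growth of `ξ_P` gives infinitely many unit windows across which the
canonical rate drops by `e^{-δ}` (`stub_exponentialRunning`), inside each of which the sum rule
selects `β⋆`.  The rest of `YangMills` is the docked UV hub, restated in PRESCRIBED-SEQUENCE form
so that the line may dictate `(β_k, a_k, L_k)` (`stub_prescribedLeg`, triage r1-3 (c)), fed by the
crux hypothesis through the canonical rate (`stub_canonicalRateGap`: `H ⇒` clustering of all pairs
at the plaquette's own rate with `β`-free constants — the dock adapter at the spectral rate) and by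
the two open inputs the card names honestly (`stub_isolatedShellAndScaling`: isolated scalar shell
with `k`-uniform relative margin; two-sided canonical scaling `Q_u ≍ a⁸` of the reference two-point
value at the locked spacing `a = m(β)`).

## Stubs (7) and composition

* S1 `stub_slabResponseIdentity` — the lattice tilted-covariance derivative (provable now, M).
* S2 `stub_cumulantWitness` — RP normalisation `c_k² Q_u = 1` + floor `c₃ Q_u^{3/2} ≤ a_k⁴ |raw slab
  cumulant|` along a scheme tied to `T` ⇒ `T.IsNontrivial ∧ T.IsNonGaussian` (provable now, M/L).
* S3 `stub_prescribedLeg` — the hub (existence + OS axioms + both gaps, ALL species) along a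
  prescribed `(b_j, a_j, L_j)`, minus the two non-triviality clauses (open-problem; = 8782/8762).
* S4 `stub_canonicalRateGap` — `H(G, r) ⇒` (GAP) at the canonical plaquette rate + (RATE) (open, L;
  the ONE place `H` is consumed).
* S5 `stub_isolatedShellAndScaling` — (SHELL) per momentum sector + (SCALE) family (open inputs).
* S6 `stub_exponentialRunning` — `m → 0` and tame `e^{-δ}`-windows (open ⇐ 8935 `XiExpLowerBound`).
* S7 `stub_slabSumRule` — the engine: package + scaling ⇒ response floor at a selected `β⋆` of
  every tame running window, on unboundedly many tori (L/XL).
`ClusteringToYangMills_of` composes them with a real proof (choice of windows, couplings, tori with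
`a_j L_j → ∞`, the leg, then S1 + S2); the skeleton audit finds it concluding the crux BY NAME.

## Disproof used (`Cruxes/ClusteringToYangMills/Disproof.lean`, cdisprove cycles 1–2: RESISTS)

No `_false_without_` theorem and no `-- Targets` exist (§5: no line picked yet).  Honoured: §2 `cruxWithoutNontriviality_trivial`
/ `yangMillsWithoutNontriviality` (ALL content sits in the interacting limit: here the two
non-triviality clauses are exactly what S1/S2/S7 manufacture, and `H` feeds the scale `a = m(β)` of
that limit through S4 — it is not decoration); `yangMills_witness_leaves_zero` (`β_k = βs(φ k) → ∞`);
§1 `not_ecAllTimes` / landed `Negative/DisproofBurden.not_latticeClusteringAllTimes` (`n ≤ S` is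
load-bearing): every clustering clause here keeps `n ≤ S` (GAP), `2n ≤ S` (RATE) or `2D + n ≤ S`
(SHELL) — no all-times statement; `ecPerVolume_trivial` (constants are `∃ C` BEFORE `∀ S`, `∀ j`
everywhere).  §3 (cycle 2) `abstract_adapter_false` / `absUTG_of_cover`: an `H ⇒ β-free constants
over all real β` upgrade is not soft — `stub_canonicalRateGap` is such an upgrade at the CANONICAL
rate and is filed as an open stub whose proof must use the RP spectral representation of genuine
Wilson correlations + the thermal bound (no `rate_sacrifice`: the lock `a = m(β)` needs the
unsacrificed rate); the composition consumes it only at the selected couplings.  The landed Negative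
module is imported so that the skeleton is checked against it.
-/

noncomputable section

open scoped SchwartzMap ComplexConjugate
open MeasureTheory ProbabilityTheory Filter Topology Complex
open Literature.MathematicalPhysics.AQFT Literature.MathematicalPhysics.QuantumLattice
open Literature.MathematicalPhysics.QuantumFieldTheory

namespace Summit.QuantumFields.YangMills.Cruxes.ClusteringToYangMills.SlabCouplingResponse

local notation "E4" => EuclideanSpace ℝ (Fin 4)

/-- Odd torus sides are never zero. -/
instance instNeZeroOddSide (S : ℕ) : NeZero (2 * S + 1) := ⟨Nat.succ_ne_zero _⟩

section Defs

variable {G : Type} [Group G] [TopologicalSpace G] [IsTopologicalGroup G] [CompactSpace G]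
  [MeasurableSpace G] [BorelSpace G]

/-! ### Torus objects at coupling `β`, half-side `S` (side `2S+1`) and spacing `a` -/

/-- The torus Wilson state `μ_{β, 2S+1}` in the representation of `r`. -/
abbrev torusState (r : LatticeRep G) (β : ℝ) (S : ℕ) : Measure (GaugeConfig 4 (2 * S + 1) G) :=
  wilsonMeasure (d := 4) (L := 2 * S + 1) r.ρ β

/-- The curvature observable (Wilson action density = `∂(action)/∂β` per site) translated to the
lattice site `y`, read on the periodic lift: `P_y(U) = P(τ_y Ũ)`. -/
def curvAt (r : LatticeRep G) (S : ℕ) (y : Literature.Probability.LatticeModels.Site 4)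
    (U : GaugeConfig 4 (2 * S + 1) G) : ℝ :=
  r.curvature.F (configShift (-y) (torusLift (2 * S + 1) U))

/-- The torus mean `⟨P⟩_{β,S}` of the curvature observable. -/
def curvMean (r : LatticeRep G) (β : ℝ) (S : ℕ) : ℝ :=
  ∫ U, curvAt r S 0 U ∂(torusState r β S)

/-- The centred, UNrenormalised (`c = 1`) smeared curvature field at spacing `a` on the torus of
half-side `S`: `φ(f)(U) = a⁴ ∑_{x ∈ box S} f(a x) (P(τₓŨ) - ⟨P⟩_{β,S})` — literally
`smearedLatticeField` with `(c, m) = (1, curvMean r β S)`; for ANY scheme renormalisations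
`(c_k, m_k)` the scheme's field is `c_k · φ(f) + const`, so joint cumulants of order ≥ 2 of the
scheme's fields are `c_kⁿ ×` those of `φ`. -/
def field (r : LatticeRep G) (β : ℝ) (S : ℕ) (a : ℝ) (f : 𝓢(E4, ℝ))
    (U : GaugeConfig 4 (2 * S + 1) G) : ℝ :=
  smearedLatticeField r.curvature.F (Literature.Probability.LatticeModels.box 4 S) a 1
    (curvMean r β S) f (torusLift (2 * S + 1) U)

/-- The reflection-positive reference two-point value `Q_u(β, S, a) = Cov_{β,S}(φ(θu), φ(u))` of a
real test function `u` supported at positive times (`θ` = time reflection of test functions;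
`≥ 0` by reflection positivity of the odd torus): the quantity whose inverse square root is the
multiplicative renormalisation of the line (`stub_prescribedLeg`). -/
def refTwoPoint (r : LatticeRep G) (β : ℝ) (S : ℕ) (a : ℝ) (u : 𝓢(E4, ℝ)) : ℝ :=
  covariance (field r β S a (thetaTest 4 u)) (field r β S a u) (torusState r β S)

/-- The slab weight `W_h = ∑_{y ∈ box S} h(a y) P_y`: a LOCAL modulation of the coupling, by
`h(a y)` on the six plaquettes based at `y` (`h` supported in a time slab ⇒ only couplings inside
the slab move). -/
def slabWeight (r : LatticeRep G) (S : ℕ) (a : ℝ) (h : 𝓢(E4, ℝ))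
    (U : GaugeConfig 4 (2 * S + 1) G) : ℝ :=
  ∑ y ∈ Literature.Probability.LatticeModels.box 4 S, h (a • siteToE y) * curvAt r S y U

/-- The locally modulated Wilson state: coupling `β + t h(a y)` on the plaquettes based at `y`, i.e.
the torus state tilted by `t W_h` — again a single-plaquette Wilson measure with positive
plaquette-dependent couplings for `|t| ‖h‖_∞ < β`. -/
def slabState (r : LatticeRep G) (β : ℝ) (S : ℕ) (a : ℝ) (h : 𝓢(E4, ℝ)) (t : ℝ) :
    Measure (GaugeConfig 4 (2 * S + 1) G) :=
  (torusState r β S).tilted fun U => t * slabWeight r S a h U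

/-- The raw slab cumulant `∫ (φf - Eφf)(φg - Eφg)(W_h - EW_h) dμ_{β,S}`: the third joint cumulant
of the two smeared fields and the slab weight.  Since `φ(h) - Eφ(h) = a⁴ (W_h - EW_h)` pointwise,
`a⁴ ×` this number is the third cumulant `κ₃(φf, φg, φh)`, and `c_k³ a_k⁴ ×` it is the connected
three-point function of the scheme's renormalised fields on `f ⊗ g ⊗ h`. -/
def rawSlabCumulant (r : LatticeRep G) (β : ℝ) (S : ℕ) (a : ℝ) (f g h : 𝓢(E4, ℝ)) : ℝ :=
  ∫ U, (field r β S a f U - ∫ V, field r β S a f V ∂(torusState r β S)) *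
      (field r β S a g U - ∫ V, field r β S a g V ∂(torusState r β S)) *
      (slabWeight r S a h U - ∫ V, slabWeight r S a h V ∂(torusState r β S)) ∂(torusState r β S)

/-- **The slab response identity at `(β, S, a; f, g; h)`**: `t ↦ Cov_{μ_t}(φf, φg)` under the
locally modulated state `μ_t = μ_{β,S}.tilted (t W_h)` is differentiable at `t = 0` with derivative
the raw slab cumulant — the response of the two-point function to raising the coupling INSIDE the
slab is the `h`-weighted off-diagonal three-point cumulant, with no contact term (they live where
`h = 0`). -/
def SlabResponseIdentityAt (r : LatticeRep G) (β : ℝ) (S : ℕ) (a : ℝ) (f g h : 𝓢(E4, ℝ)) :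
    Prop :=
  HasDerivAt (fun t : ℝ => covariance (field r β S a f) (field r β S a g) (slabState r β S a h t))
    (rawSlabCumulant r β S a f g h) 0

/-! ### Vocabulary of the spectral (transfer-matrix) inputs, in correlator language -/

/-- The links of the torus of side `L` lying in the positive time slab `1 ≤ t ≤ D`, endpoints
included (temporal links based at `t` end at `t + 1`); inside the positive half of the odd-torus
reflection `θ t = 1 - t` when `2D + 1 ≤ L`. -/
def slabEdges (L D : ℕ) : Set (Edge 4 L) :=
  {e | 1 ≤ (e.1 0).val ∧ (e.1 0).val ≤ D ∧ (e.2 = 0 → (e.1 0).val + 1 ≤ D)}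

/-- Time shift of torus configurations by `n` lattice units, `(timeShift n U)(x, i) = U(x + n e₀, i)`
(the sign convention of `latticeConnectedCorr`). -/
def timeShift {L : ℕ} (n : ℕ) (U : GaugeConfig 4 L G) : GaugeConfig 4 L G :=
  torusConfigShift (-(Pi.single (0 : Fin 4) ((n : ℕ) : ZMod L))) U

/-- The reflection-positivity pairing `⟨Θ F̄ · G⟩_{β,S}` on the odd torus, `(ΘF̄)(U) = conj F(θU)`
with Wave 0's `GaugeConfig.timeReflect` (`θ t = 1 - t`). -/
def rpPair (r : LatticeRep G) (β : ℝ) (S : ℕ) (F G' : GaugeConfig 4 (2 * S + 1) G → ℂ) : ℂ :=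
  wilsonExpectation (d := 4) (L := 2 * S + 1) r.ρ β fun U => conj (F U.timeReflect) * G' U

/-- The torus mean `⟨F⟩_{β,S}` of a complex observable. -/
def tmean (r : LatticeRep G) (β : ℝ) (S : ℕ) (F : GaugeConfig 4 (2 * S + 1) G → ℂ) : ℂ :=
  wilsonExpectation (d := 4) (L := 2 * S + 1) r.ρ β F

omit [Group G] [TopologicalSpace G] [IsTopologicalGroup G] [CompactSpace G] [MeasurableSpace G]
  [BorelSpace G] in
/-- The character of the spatial translation group `(ℤ/(2S+1))³` of the torus with (integer
representative of the) lattice momentum `p` (`p 0` is ignored: only `v` with `v 0 = 0` are used). -/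
def torusChar (S : ℕ) (p : Fin 4 → ℤ)
    (v : Literature.MathematicalPhysics.QuantumFieldTheory.Site 4 (2 * S + 1)) : ℂ :=
  Complex.exp (2 * Real.pi * Complex.I *
    (((∑ j : Fin 4, if j = 0 then (0 : ℝ) else (p j : ℝ) * ((v j).val : ℝ)) / (2 * S + 1 : ℝ) : ℝ) : ℂ))

/-- `F` has spatial lattice momentum `p` on the torus of half-side `S`. -/
def HasMomentum (S : ℕ) (p : Fin 4 → ℤ) (F : GaugeConfig 4 (2 * S + 1) G → ℂ) : Prop :=
  ∀ v : Literature.MathematicalPhysics.QuantumFieldTheory.Site 4 (2 * S + 1), v 0 = 0 →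
    ∀ U, F (torusConfigShift v U) = torusChar S p v * F U

omit [Group G] [TopologicalSpace G] [IsTopologicalGroup G] [CompactSpace G] [MeasurableSpace G]
  [BorelSpace G] in
/-- Squared spatial lattice momentum `∑_{j=1}^{3} (2π p_j/(2S+1))²` of the representative `p`. -/
def momSq (S : ℕ) (p : Fin 4 → ℤ) : ℝ :=
  ∑ j : Fin 4, if j = 0 then (0 : ℝ) else (2 * Real.pi * (p j : ℝ) / (2 * S + 1 : ℝ)) ^ 2

/-- **(GAP)** volume-uniform clustering of EVERY pair of local gauge-invariant observables at the
canonical rate `m β`, with `β`-free per-pair constants, on all tori `S ≥ S₀ β` and all `n ≤ S` —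
the atoms of `HasLatticeMassGap`, at the rate the correlation length dictates (what the crux's
hypothesis delivers through reflection positivity / the transfer-matrix gap with RP-normalised
constants plus the thermal bound on symmetric tori; = the dock adapter AT THE SPECTRAL RATE of
triage r1-1/2/3).  It forces `m β ≤` the true torus gap; with (RATE) the lightest state is the one
the plaquette creates. -/
def UniformGapAt (r : LatticeRep G) (m : ℝ → ℝ) (S₀ : ℝ → ℕ) (β₁ : ℝ) : Prop :=
  ∀ A B : YMSpecies G, ∃ C : ℝ, ∀ β : ℝ, β₁ ≤ β → ∀ S : ℕ, S₀ β ≤ S → ∀ n : ℕ, n ≤ S →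
    |latticeConnectedCorr r.ρ β (2 * S + 1) A.F B.F n| ≤ C * Real.exp (-(m β * n))

/-- **(RATE)** `m β ∈ (0, 1]` is THE plaquette rate: two-sided exponential bounds for the axial
curvature autocorrelation on all large tori up to half the period — the lower one with a polynomial
slack `(n+1)⁴` (the momentum integral of a one-particle shell gives `e^{-mn} n^{-3/2}` in `d = 4`) —
so that `m β` is pinned to the true plaquette mass `-lim n⁻¹ log corr`, i.e. `ξ_P(β) = 1/m β`; the
lower bound says the plaquette couples to the lightest state (a particle). -/
def IsPlaquetteRate (r : LatticeRep G) (m : ℝ → ℝ) (S₀ : ℝ → ℕ) (β₁ : ℝ) : Prop :=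
  ∀ β : ℝ, β₁ ≤ β → 0 < m β ∧ m β ≤ 1 ∧ ∃ A C : ℝ, 0 < A ∧ ∀ S : ℕ, S₀ β ≤ S → ∀ n : ℕ, 2 * n ≤ S →
    A * Real.exp (-(m β * n)) ≤
        ((n : ℝ) + 1) ^ 4 * latticeConnectedCorr r.ρ β (2 * S + 1) r.curvature.F r.curvature.F n ∧
      latticeConnectedCorr r.ρ β (2 * S + 1) r.curvature.F r.curvature.F n ≤
        C * Real.exp (-(m β * n))

/-- **(SCALE)** two-sided canonical scaling of the reference two-point value at the LOCKED spacing
`a = m β` (one plaquette correlation length = one physical unit): `q₀ a⁸ ≤ Q_u(β, S, a) ≤ K₀ a⁸` on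
large tori — the bare curvature fluctuation field at the physical scale is `a⁴ ×` a field with
finite non-zero correlations (`δP ≈ (a⁴/2b₀) θ`, no anomalous dimension; the lower bound is
non-ultralocality = non-triviality at the scale, the upper bound the k-uniform two-point bound). -/
def CanonicalScaling (r : LatticeRep G) (m : ℝ → ℝ) (S₀ : ℝ → ℕ) (β₁ : ℝ) (u : 𝓢(E4, ℝ))
    (q₀ K₀ : ℝ) : Prop :=
  ∀ β : ℝ, β₁ ≤ β → ∀ S : ℕ, S₀ β ≤ S →
    q₀ * (m β) ^ 8 ≤ refTwoPoint r β S (m β) u ∧ refTwoPoint r β S (m β) u ≤ K₀ * (m β) ^ 8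

/-- **(SHELL)** the isolated one-particle shell of the torus transfer matrix, per spatial momentum
sector, in correlator language.  Data: energies `E β S p` of the lowest state of lattice momentum
`p` on the torus of half-side `S` at coupling `β` (sectors with nothing below `(1 + μ₀) m β` take
`E ≥ (1+μ₀) m β`, amplitude `0`), with `E β S 0` the canonical rate up to an exponentially small
finite-size shift and the non-relativistic dispersion bound `E β S p ≤ E β S 0 + κ |p̂|²/m β`.  For
all bounded measurable gauge-invariant observables `F, G` of the slab `1 ≤ t ≤ D` with momentum `p`
the reflection-positive time correlation is ONE exponential at rate `E β S p` up to (i) the rest of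
the sector's spectrum, at relative margin `μ₀` and in RP norms `‖F‖²_RP = Re⟨ΘF̄F⟩ - |⟨F⟩|²` (the
norms the continuum limit sees), and (ii) the thermal wrap-around of the period `2S+1` in sup norms.
This is "the scalar glueball is an isolated simple level below `min(m(0⁺⁺*), 2m)`, uniformly in β"
(physically `μ₀ ≈ 0.4–0.6`), the infrared spectral input of crux ideas running-pole-skewness /
slab-coupling-response; without it edge spectral densities let contact terms fake running. -/
def IsolatedShell (r : LatticeRep G) (m : ℝ → ℝ) (E : ℝ → ℕ → (Fin 4 → ℤ) → ℝ) (S₀ : ℝ → ℕ)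
    (β₁ μ₀ K κ : ℝ) : Prop :=
  ∀ β : ℝ, β₁ ≤ β → ∀ S : ℕ, S₀ β ≤ S →
    |E β S 0 - m β| ≤ K * Real.exp (-(m β * S / 2)) ∧
    (∀ p : Fin 4 → ℤ, p 0 = 0 → m β ≤ E β S p ∧ E β S p ≤ E β S 0 + κ * momSq S p / m β) ∧
    ∀ p : Fin 4 → ℤ, p 0 = 0 → ∀ (D : ℕ) (F G' : GaugeConfig 4 (2 * S + 1) G → ℂ) (C_F C_G : ℝ),
      Measurable F → Measurable G' → (∀ U, ‖F U‖ ≤ C_F) → (∀ U, ‖G' U‖ ≤ C_G) →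
      DependsOn F (slabEdges (2 * S + 1) D) → DependsOn G' (slabEdges (2 * S + 1) D) →
      IsGaugeInvariant F → IsGaugeInvariant G' → HasMomentum S p F → HasMomentum S p G' →
        ∃ Amp : ℂ, ∀ n : ℕ, 2 * D + n ≤ S →
          ‖rpPair r β S F (G' ∘ timeShift n) - conj (tmean r β S F) * tmean r β S G' -
              Amp * (Real.exp (-(E β S p * n)) : ℂ)‖ ≤
            K * Real.sqrt ((rpPair r β S F F).re - ‖tmean r β S F‖ ^ 2) *
                Real.sqrt ((rpPair r β S G' G').re - ‖tmean r β S G'‖ ^ 2) *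
                Real.exp (-((1 + μ₀) * m β * n)) +
              K * C_F * C_G * Real.exp (-(m β * S / 2))

/-- **The spectral package of `(G, r)` above `β₁`**: margin `μ₀ > 0`, (GAP), (RATE), (SHELL). -/
def SpectralPackage (r : LatticeRep G) (m : ℝ → ℝ) (E : ℝ → ℕ → (Fin 4 → ℤ) → ℝ) (S₀ : ℝ → ℕ)
    (β₁ μ₀ K κ : ℝ) : Prop :=
  0 < μ₀ ∧ UniformGapAt r m S₀ β₁ ∧ IsPlaquetteRate r m S₀ β₁ ∧ IsolatedShell r m E S₀ β₁ μ₀ K κ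

end Defs

/-! ### The registered stubs (statements) -/

namespace Statement

/-- Stub S1 — the slab response identity (see `SlabResponseIdentityAt`): provable now (dominated
differentiation of `t ↦ ∫ F G e^{tW} dμ / ∫ e^{tW} dμ` and of the two tilted means, then algebra:
`d/dt Cov = Cov(FG, W) - Cov(F, W) EG - EF Cov(G, W) = κ₃(F, G, W)`; `F, G, W` are bounded measurable
and `μ_{β,S}` is a probability measure for continuous `ρ`). -/
def stub_slabResponseIdentity : Prop :=
  ∀ (G : Type) [Group G] [TopologicalSpace G] [IsTopologicalGroup G] [CompactSpace G]
    [MeasurableSpace G] [BorelSpace G] (r : LatticeRep G) (β : ℝ) (S : ℕ) (a : ℝ)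
    (f g h : 𝓢(E4, ℝ)), SlabResponseIdentityAt r β S a f g h

/-- Stub S2 — the cumulant witness (soft, provable now): along ANY Wilson scheme tied to OS data
`T` by `IsYangMillsFor`, an RP normalisation `c_k² Q_u(k) = 1` of the curvature field on a real
reference pair `(θu, u)` makes `T` non-trivial in `tr F²` (landed `Negative.twoPointNontrivial_of_real`
shape), and a `k`-uniform floor `c₃ Q_u^{3/2} ≤ a_k⁴ |raw slab cumulant(f, g, h)|` on three time-
separated real test functions makes it non-Gaussian: `c_k³ a_k⁴ × raw` is the connected three-point
function of the scheme's renormalised fields (cumulants are blind to the additive counterterms),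
the sub-tensors of `f ⊗ g ⊗ h` are off-diagonal by the separation of supports, every lattice value
converges by `IsYangMillsFor`, and `c³ Q √Q = 1`. -/
def stub_cumulantWitness : Prop :=
  ∀ (G : Type) [Group G] [TopologicalSpace G] [IsTopologicalGroup G] [CompactSpace G]
    [MeasurableSpace G] [BorelSpace G] (r : LatticeRep G) (sch : SpeciesScheme (YMSpecies G))
    (T : OSData (YMSpecies G) 4), IsYangMillsFor r sch T →
    ∀ (u f g h : 𝓢(E4, ℝ)) (τ c₃ : ℝ), 0 < τ → 0 < c₃ →
      tsupport (u : E4 → ℝ) ⊆ {y : E4 | 0 < y 0} →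
      tsupport (f : E4 → ℝ) ⊆ {y : E4 | y 0 < -τ} →
      tsupport (h : E4 → ℝ) ⊆ {y : E4 | -(τ / 2) < y 0 ∧ y 0 < τ / 2} →
      tsupport (g : E4 → ℝ) ⊆ {y : E4 | τ < y 0} →
      (∀ k : ℕ, 0 < sch.c r.curvature k ∧
        (sch.c r.curvature k) ^ 2 * refTwoPoint r (sch.β k) (sch.L k) (sch.a k) u = 1) →
      (∀ k : ℕ, c₃ * refTwoPoint r (sch.β k) (sch.L k) (sch.a k) u *
          Real.sqrt (refTwoPoint r (sch.β k) (sch.L k) (sch.a k) u) ≤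
        (sch.a k) ^ 4 * |rawSlabCumulant r (sch.β k) (sch.L k) (sch.a k) f g h|) →
      T.IsNontrivial r.curvature ∧ T.IsNonGaussian r.curvature

/-- Stub S3 — the existence leg in PRESCRIBED-SEQUENCE form (the docked UV hub, triage r1-3 (c)):
for compact simple `G` and faithful `r`, along any prescribed couplings `b_j → ∞`, spacings
`a_j → 0` and torus half-sides `L_j` with `a_j L_j → ∞` such that (i) every pair of local
gauge-invariant observables clusters on all tori `S ≥ L_j`, `n ≤ S`, at lattice rate `a_j` with
`j`-free per-pair constants (`HasLatticeMassGap` re-indexed: the lattice gap IS the ruler) and (ii)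
the reference two-point value at spacing `a_j` on the torus `L_j` is not ultralocal, `Q_u ≥ q₀ a_j⁸`,
there are a SUBSEQUENCE `φ`, a Wilson scheme through it (`β_k = b_{φ k}`, `a_k = a_{φ k}`,
`L_k = L_{φ k}`, curvature renormalised by `c_k = Q_u(k)^{-1/2}`) and OS data `T` (E0, E0', E1–E4
for ALL species) with `IsYangMillsFor r sch T` and a mass gap of the full Hamiltonian, continuum and
lattice.  Everything of `YangMills` except the two non-triviality clauses — open (k-uniform
E0'/tightness by compactness along a diagonal subsequence, E1 rotations, gap transfer): items
8782 / 8762 restated so that a line may prescribe WHERE on the coupling axis, at which spacing and on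
which tori the scheme sits. -/
def stub_prescribedLeg : Prop :=
  ∀ (G : Type) [Group G] [TopologicalSpace G] [IsTopologicalGroup G] [CompactSpace G]
    [MeasurableSpace G] [BorelSpace G] (r : LatticeRep G), IsCompactSimpleLieGroup G →
    ∀ (b a : ℕ → ℝ) (L : ℕ → ℕ) (u : 𝓢(E4, ℝ)) (q₀ : ℝ),
      Tendsto b atTop atTop → (∀ j, 0 < a j) → Tendsto a atTop (𝓝 0) →
      Tendsto (fun j => a j * (L j : ℝ)) atTop atTop →
      tsupport (u : E4 → ℝ) ⊆ {y : E4 | 0 < y 0} → 0 < q₀ →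
      (∀ A B : YMSpecies G, ∃ C : ℝ, ∀ j S : ℕ, L j ≤ S → ∀ n : ℕ, n ≤ S →
        |latticeConnectedCorr r.ρ (b j) (2 * S + 1) A.F B.F n| ≤ C * Real.exp (-(a j * n))) →
      (∀ j : ℕ, q₀ * (a j) ^ 8 ≤ refTwoPoint r (b j) (L j) (a j) u) →
      ∃ (φ : ℕ → ℕ) (sch : SpeciesScheme (YMSpecies G)) (T : OSData (YMSpecies G) 4),
        StrictMono φ ∧ (∀ k, sch.β k = b (φ k)) ∧ (∀ k, sch.a k = a (φ k)) ∧
        (∀ k, sch.L k = L (φ k)) ∧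
        (∀ k, 0 < sch.c r.curvature k ∧
          (sch.c r.curvature k) ^ 2 * refTwoPoint r (sch.β k) (sch.L k) (sch.a k) u = 1) ∧
        IsYangMillsFor r sch T ∧ ∃ Δ : ℝ, 0 < Δ ∧ T.HasMassGap Δ ∧ HasLatticeMassGap r sch Δ

/-- Stub S4 — the canonical rate from the crux hypothesis: volume-uniform exponential clustering at
every `β ≥ β₀` (per-`β` constants, some rate) upgrades, by reflection positivity / the transfer-
matrix spectral gap on symmetric tori, to (GAP) at the plaquette's own rate `m β` with `β`-free
per-pair constants on tori `S ≥ S₀ β`, together with (RATE).  The one place the line consumes `H`;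
bets that the lightest state sits in the plaquette's channel. -/
def stub_canonicalRateGap : Prop :=
  ∀ (G : Type) [Group G] [TopologicalSpace G] [IsTopologicalGroup G] [CompactSpace G]
    [MeasurableSpace G] [BorelSpace G] (r : LatticeRep G), IsCompactSimpleLieGroup G →
    (∃ β₀ : ℝ, ∀ β : ℝ, β₀ ≤ β → ∃ m : ℝ, 0 < m ∧ ∀ A B : YMSpecies G, ∃ C : ℝ, ∀ S n : ℕ,
        n ≤ S → |latticeConnectedCorr r.ρ β (2 * S + 1) A.F B.F n| ≤ C * Real.exp (-(m * n))) →
    ∃ (m : ℝ → ℝ) (S₀ : ℝ → ℕ) (β₁ : ℝ), UniformGapAt r m S₀ β₁ ∧ IsPlaquetteRate r m S₀ β₁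

/-- Stub S5 — the isolated shell and canonical scaling (open infrared-spectral and UV-scaling
inputs, NOT implied by the crux hypothesis): a canonical rate as in S4 comes with an isolated
one-particle shell (SHELL) and, for every non-zero positive-time reference `u`, two-sided canonical
scaling (SCALE) of `Q_u` at the locked spacing beyond `u`-dependent thresholds (the lattice `m(β) ℤ⁴`
must resolve the support of `u` and the torus must contain it) — possibly after enlarging the
package thresholds. -/
def stub_isolatedShellAndScaling : Prop :=
  ∀ (G : Type) [Group G] [TopologicalSpace G] [IsTopologicalGroup G] [CompactSpace G]
    [MeasurableSpace G] [BorelSpace G] (r : LatticeRep G), IsCompactSimpleLieGroup G →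
    ∀ (m : ℝ → ℝ) (S₀ : ℝ → ℕ) (β₁ : ℝ), UniformGapAt r m S₀ β₁ → IsPlaquetteRate r m S₀ β₁ →
      ∃ (E : ℝ → ℕ → (Fin 4 → ℤ) → ℝ) (S₁ : ℝ → ℕ) (β₂ μ₀ K κ : ℝ),
        SpectralPackage r m E S₁ β₂ μ₀ K κ ∧
        ∀ u : 𝓢(E4, ℝ), tsupport (u : E4 → ℝ) ⊆ {y : E4 | 0 < y 0} → u ≠ 0 →
          ∃ (q₀ K₀ β₃ : ℝ) (S₃ : ℝ → ℕ), 0 < q₀ ∧ CanonicalScaling r m S₃ β₃ u q₀ K₀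

/-- Stub S6 — exponential running of the canonical rate (asymptotic-freedom-SHAPED growth of the
plaquette correlation length; open, implied by `XiCompleteMonotonicity.XiExpLowerBound`
(stmt-8935) + limit-point glue of the 12318 kind): a two-sided plaquette rate tends to `0`
(criticality, = stmt-8941) and drops by a fixed factor `e^{-δ}` across infinitely many unit windows
of the coupling (pigeonhole from `m β ≤ K β e^{-cβ}`), windows on which it does not spike up (tame:
`m ≤ 2 m(b)` inside; eventual monotonicity of `ξ_P` in all but name).  Polynomial growth of `ξ_P`
would give windows with `δ → 0` only, and the line's floor would vanish: the lever is tied to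
dimensional transmutation, not merely to `ξ → ∞`. -/
def stub_exponentialRunning : Prop :=
  ∀ (G : Type) [Group G] [TopologicalSpace G] [IsTopologicalGroup G] [CompactSpace G]
    [MeasurableSpace G] [BorelSpace G] (r : LatticeRep G), IsCompactSimpleLieGroup G →
    ∀ (m : ℝ → ℝ) (S₀ : ℝ → ℕ) (β₁ : ℝ), IsPlaquetteRate r m S₀ β₁ →
      Tendsto m atTop (𝓝 0) ∧
      ∃ δ : ℝ, 0 < δ ∧ ∀ b₀ : ℝ, ∃ b : ℝ, b₀ ≤ b ∧ β₁ ≤ b ∧ m (b + 1) ≤ Real.exp (-δ) * m b ∧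
        ∀ β' : ℝ, b ≤ β' → β' ≤ b + 1 → m β' ≤ 2 * m b

/-- Stub S7 — **the slab sum rule** (the engine: Feynman–Hellmann for the isolated shell + analytic
eigenvalue branches on each finite torus (Kato) + the transfer-matrix anatomy of a slab insertion +
a measure-theoretic mean-value selection on the window): given the spectral package and canonical
scaling of every reference two-point value, for every running strength `δ > 0` there are a
reference `u ≠ 0`, three real test functions `f` (before the slab), `h` (the slab profile), `g`
(after the slab), time-separated by `τ`, `c₃ > 0` and a threshold `β₇` such that on every tame
unit window beyond `β₇` across which the rate drops by `e^{-δ}` some coupling `β⋆` of the window has, on an UNBOUNDED set of torus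
sizes `S` and at the locked spacing `a = m β⋆`, the RESPONSE FLOOR
`c₃ Q_u^{3/2} ≤ a⁴ |d/dt|₀ Cov_{β⋆ + t h}(φf, φg)|` — lengthening the correlation length inside the
slab moves the two-point function across it at first order (diagonal FH term of the shell
`≈ -(τ/a) E′(β⋆) Cov(φf, φg)` with `|E′| ≥ (1 - e^{-δ}) m/2` somewhere in the window on every large
torus, hence at one `β⋆` for infinitely many `S`; off-shell terms suppressed by `e^{-μ₀ m τ/(2a)}`;
units converted by (SCALE)).  Stated for ANY value `K'` of the derivative, which S1 identifies as the
raw slab cumulant. -/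
def stub_slabSumRule : Prop :=
  ∀ (G : Type) [Group G] [TopologicalSpace G] [IsTopologicalGroup G] [CompactSpace G]
    [MeasurableSpace G] [BorelSpace G] (r : LatticeRep G), IsCompactSimpleLieGroup G →
    ∀ (m : ℝ → ℝ) (E : ℝ → ℕ → (Fin 4 → ℤ) → ℝ) (S₀ : ℝ → ℕ) (β₁ μ₀ K κ : ℝ),
      SpectralPackage r m E S₀ β₁ μ₀ K κ →
      (∀ u' : 𝓢(E4, ℝ), tsupport (u' : E4 → ℝ) ⊆ {y : E4 | 0 < y 0} → u' ≠ 0 →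
        ∃ (q₀ K₀ β₃ : ℝ) (S₃ : ℝ → ℕ), 0 < q₀ ∧ CanonicalScaling r m S₃ β₃ u' q₀ K₀) →
      ∀ δ : ℝ, 0 < δ →
      ∃ (u f g h : 𝓢(E4, ℝ)) (τ c₃ β₇ : ℝ),
        tsupport (u : E4 → ℝ) ⊆ {y : E4 | 0 < y 0} ∧ u ≠ 0 ∧ 0 < τ ∧ 0 < c₃ ∧
        tsupport (f : E4 → ℝ) ⊆ {y : E4 | y 0 < -τ} ∧
        tsupport (h : E4 → ℝ) ⊆ {y : E4 | -(τ / 2) < y 0 ∧ y 0 < τ / 2} ∧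
        tsupport (g : E4 → ℝ) ⊆ {y : E4 | τ < y 0} ∧
        ∀ b : ℝ, β₇ ≤ b → m (b + 1) ≤ Real.exp (-δ) * m b →
          (∀ β' : ℝ, b ≤ β' → β' ≤ b + 1 → m β' ≤ 2 * m b) →
          ∃ βs : ℝ, b ≤ βs ∧ βs ≤ b + 1 ∧ ∀ S' : ℕ, ∃ S : ℕ, S' ≤ S ∧
            ∀ K' : ℝ, HasDerivAt (fun t : ℝ => covariance (field r βs S (m βs) f)
                (field r βs S (m βs) g) (slabState r βs S (m βs) h t)) K' 0 →
              c₃ * refTwoPoint r βs S (m βs) u * Real.sqrt (refTwoPoint r βs S (m βs) u) ≤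
                (m βs) ^ 4 * |K'|

end Statement

/-! ### The registered stubs (sorried) -/

/-- S1. -/
theorem stub_slabResponseIdentity : Statement.stub_slabResponseIdentity := by
  sorry

/-- S2. -/
theorem stub_cumulantWitness : Statement.stub_cumulantWitness := by
  sorry

/-- S3. -/
theorem stub_prescribedLeg : Statement.stub_prescribedLeg := by
  sorry

/-- S4. -/
theorem stub_canonicalRateGap : Statement.stub_canonicalRateGap := by
  sorry

/-- S5. -/
theorem stub_isolatedShellAndScaling : Statement.stub_isolatedShellAndScaling := by
  sorry

/-- S6. -/
theorem stub_exponentialRunning : Statement.stub_exponentialRunning := by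
  sorry

/-- S7. -/
theorem stub_slabSumRule : Statement.stub_slabSumRule := by
  sorry

/-! ### The composition: the crux from the seven stubs -/

/-- **`ClusteringToYangMills` from the seven stubs** (kernel-checked, no `sorry` here).  For a
compact simple `G` take the faithful `r` it provides and the crux hypothesis `H(G, r)`; S4 turns it
into the canonical rate `m`, S5 adds the shell and the scaling family, S6 gives `m → 0` and the tame
running windows `[b_j, b_j + 1]` (`b_j ≥ j`), S7 selects in each window a coupling `βs j` and an
unbounded set of tori carrying the response floor; lock `a_j := m(βs j)` and pick `L_j` in that set
beyond the package thresholds and `j / a_j` (so `a_j L_j → ∞`); S3 builds, along a subsequence, the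
normalised scheme and the OS data with `IsYangMillsFor` and both gaps; S1 identifies the response
with the raw slab cumulant, so the floor is a floor on the cumulant at the scheme's own parameters,
and S2 turns normalisation + floor into `IsNontrivial ∧ IsNonGaussian` of `tr F²`. -/
theorem ClusteringToYangMills_of :
    Statement.stub_slabResponseIdentity → Statement.stub_cumulantWitness →
      Statement.stub_prescribedLeg → Statement.stub_canonicalRateGap →
      Statement.stub_isolatedShellAndScaling → Statement.stub_exponentialRunning →
      Statement.stub_slabSumRule →
        Summit.QuantumFields.YangMills.Theses.FradkinShenkerFlow.ClusteringToYangMills := by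
  intro hS1 hS2 hS3 hS4 hS5 hS6 hS7 H G _ _ _ _ hG
  letI : MeasurableSpace G := borel G
  haveI : BorelSpace G := ⟨rfl⟩
  obtain ⟨r⟩ := hG.2
  -- the crux hypothesis for `(G, r)`, then the spectral package and the scaling family
  obtain ⟨m, S₀, β₁, hgap, hrate⟩ := hS4 G r hG (H G hG r)
  obtain ⟨E, S₁, β₂, μ₀, K, κ, hpack, hscale⟩ := hS5 G r hG m S₀ β₁ hgap hrate
  obtain ⟨hm0, δ, hδ, hwin⟩ := hS6 G r hG m S₁ β₂ hpack.2.2.1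
  obtain ⟨u, f, g, h, τ, c₃, β₇, hu, hu0, hτ, hc₃, hf, hh, hg, hfloor⟩ :=
    hS7 G r hG m E S₁ β₂ μ₀ K κ hpack hscale δ hδ
  obtain ⟨q₀, K₀, β₃, S₃, hq₀, hcs⟩ := hscale u hu hu0
  -- tame running windows `[b j, b j + 1]` beyond `j`, `β₂`, `β₃`, `β₇`; selected couplings `βs j`
  choose b hb using fun j : ℕ => hwin (max (max (j : ℝ) β₂) (max β₃ β₇))
  choose βs hβs using fun j : ℕ =>
    hfloor (b j) (le_trans (le_trans (le_max_right _ _) (le_max_right _ _)) (hb j).1) (hb j).2.2.1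
      (hb j).2.2.2
  have hβs_ge : ∀ j : ℕ, (j : ℝ) ≤ βs j := fun j =>
    le_trans (le_trans (le_trans (le_max_left _ _) (le_max_left _ _)) (hb j).1) (hβs j).1
  have hβs_β₂ : ∀ j : ℕ, β₂ ≤ βs j := fun j =>
    le_trans (le_trans (le_trans (le_max_right _ _) (le_max_left _ _)) (hb j).1) (hβs j).1
  have hβs_β₃ : ∀ j : ℕ, β₃ ≤ βs j := fun j =>
    le_trans (le_trans (le_trans (le_max_left _ _) (le_max_right _ _)) (hb j).1) (hβs j).1
  have hapos : ∀ j : ℕ, 0 < m (βs j) := fun j => (hpack.2.2.1 (βs j) (hβs_β₂ j)).1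
  -- the tori: in the floor-carrying set, beyond the package/scaling thresholds and `j / a_j`
  choose L hL using fun j : ℕ =>
    (hβs j).2.2 (max (max (S₁ (βs j)) (S₃ (βs j))) ⌈(j : ℝ) / m (βs j)⌉₊)
  have hLS₁ : ∀ j : ℕ, S₁ (βs j) ≤ L j := fun j =>
    le_trans (le_trans (le_max_left _ _) (le_max_left _ _)) (hL j).1
  have hLS₃ : ∀ j : ℕ, S₃ (βs j) ≤ L j := fun j =>
    le_trans (le_trans (le_max_right _ _) (le_max_left _ _)) (hL j).1
  -- prescribed data for the leg
  have hbT : Tendsto βs atTop atTop :=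
    tendsto_atTop_mono hβs_ge tendsto_natCast_atTop_atTop
  have haT : Tendsto (fun j => m (βs j)) atTop (𝓝 0) := hm0.comp hbT
  have haL : Tendsto (fun j : ℕ => m (βs j) * (L j : ℝ)) atTop atTop := by
    refine tendsto_atTop_mono (fun j => ?_) tendsto_natCast_atTop_atTop
    have hm := hapos j
    have h1 : ((⌈(j : ℝ) / m (βs j)⌉₊ : ℕ) : ℝ) ≤ (L j : ℝ) := by
      exact_mod_cast le_trans (le_max_right _ _) (hL j).1
    have h2 : (j : ℝ) / m (βs j) ≤ ((⌈(j : ℝ) / m (βs j)⌉₊ : ℕ) : ℝ) := Nat.le_ceil _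
    calc (j : ℝ) = m (βs j) * ((j : ℝ) / m (βs j)) := by field_simp
      _ ≤ m (βs j) * (L j : ℝ) := mul_le_mul_of_nonneg_left (h2.trans h1) hm.le
  have hgapseq : ∀ A B : YMSpecies G, ∃ C : ℝ, ∀ j S : ℕ, L j ≤ S → ∀ n : ℕ, n ≤ S →
      |latticeConnectedCorr r.ρ (βs j) (2 * S + 1) A.F B.F n| ≤
        C * Real.exp (-(m (βs j) * n)) := by
    intro A B
    obtain ⟨C, hC⟩ := hpack.2.1 A B
    exact ⟨C, fun j S hS n hn => hC (βs j) (hβs_β₂ j) S (le_trans (hLS₁ j) hS) n hn⟩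
  have hnondeg : ∀ j : ℕ, q₀ * (m (βs j)) ^ 8 ≤ refTwoPoint r (βs j) (L j) (m (βs j)) u :=
    fun j => (hcs (βs j) (hβs_β₃ j) (L j) (hLS₃ j)).1
  obtain ⟨φ, sch, T, -, hβk, hak, hLk, hnorm, hYM, Δ, hΔ, hgapT, hlat⟩ :=
    hS3 G r hG βs (fun j => m (βs j)) L u q₀ hbT hapos haT haL hu hq₀ hgapseq hnondeg
  -- the witness: normalisation from the leg, the floor from the sum rule + the identity
  have hfl : ∀ k : ℕ, c₃ * refTwoPoint r (sch.β k) (sch.L k) (sch.a k) u *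
      Real.sqrt (refTwoPoint r (sch.β k) (sch.L k) (sch.a k) u) ≤
        (sch.a k) ^ 4 * |rawSlabCumulant r (sch.β k) (sch.L k) (sch.a k) f g h| := by
    intro k
    have h1 := (hL (φ k)).2 (rawSlabCumulant r (βs (φ k)) (L (φ k)) (m (βs (φ k))) f g h)
      (hS1 G r (βs (φ k)) (L (φ k)) (m (βs (φ k))) f g h)
    rw [hβk k, hak k, hLk k]
    exact h1
  obtain ⟨hnt, hng⟩ := hS2 G r sch T hYM u f g h τ c₃ hτ hc₃ hu hf hh hg hnorm hfl
  exact ⟨r, sch, T, hYM, hnt, hng, Δ, hΔ, hgapT, hlat⟩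

/-- The crux modulo the registered stubs (here `sorry` enters, through the stubs only). -/
example : Summit.QuantumFields.YangMills.Theses.FradkinShenkerFlow.ClusteringToYangMills :=
  ClusteringToYangMills_of stub_slabResponseIdentity stub_cumulantWitness stub_prescribedLeg
    stub_canonicalRateGap stub_isolatedShellAndScaling stub_exponentialRunning stub_slabSumRule

end Summit.QuantumFields.YangMills.Cruxes.ClusteringToYangMills.SlabCouplingResponse

end
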